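import Mathlib
import HarnessLib
import Summits.ResolutionOfSingularities.ResolutionOfSingularities.Theorems.WildQuotientsWildQuotientResolutionBlowupExitBasicOpenSections

/-!
# The seam with POINTS: basic opens of the sections `Ω y` of a stable chart `D₊(s)`, read in `Spec (R[It])_{(s)}`
(crux stmt-ResolutionOfSingularities-15640 `WildQuotients.WildQuotientResolution`, line `Sketch`; chain w45c post-V5
programme S2 brick F3 — lead-1's `FrameBrick` (`L/res-L1-w45c-lead-1/stubs/ConductorOneF8Sig.lean` d7f6f5f4537369e2)
carries a BOOLEAN-POINT SEPARATION clause phrased with `zeroLocus (e.symm '' …)` on the pieces, which needs the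
sections `Ω y` of the seam read as functions on the affine chart `D₊(s) ≅ Spec (R[It])_{(s)}`; res-L1-w45c-plan-1 NO
OBJECTION 2026-08-27T19:44:04Z. [OURS · L1 W4.5c] — NOT a statement of any manuscript; replaces the role of no printed
item. Prover res-D-pv-033.)

* `ι_base_mem_basicOpen_iff` — for `x ∈ D₊(s)` and a homogeneous `g` of positive degree:
  `x ∈ D₊(g) ↔ θ_g ∉ 𝔮ₓ`, where `𝔮ₓ ∈ Spec (R[It])_{(s)}` is the point of `x` under Mathlib's
  `Proj.basicOpenIsoSpec` and `θ_g = g^{deg s}/s^{deg g}` (`Away.isLocalizationElem`; Mathlib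
  `Proj.awayι_preimage_basicOpen`);
* **`exists_basicOpen_sectionsEquiv_points`** — the seam `Ω` of `…BlowupExitBasicOpenSections` (same proof) with the
  extra clause (iii): `x ∈ (↥D₊(s)).basicOpen (Ω y) ↔ y ∉ 𝔮ₓ` (Mathlib `Proj.basicOpenToSpec_app_top`,
  `Scheme.preimage_basicOpen_top`, `basicOpen_eq_of_affine`).
-/

-- single-problem summit: the doubled namespace component `ResolutionOfSingularities` is forced
set_option linter.dupNamespace false

noncomputable section

open CategoryTheory AlgebraicGeometry TopologicalSpace Polynomial HomogeneousLocalization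
open Literature.AlgebraicGeometry.Resolution Literature.AlgebraicGeometry.RelativeSpec
open scoped Pointwise

namespace Summit.ResolutionOfSingularities.ResolutionOfSingularities.Theorems.WildQuotientResolution.BlowupExit

universe u

/-! ## Points of `D₊(s)` and basic opens of `Proj` -/

/-- **`x ∈ D₊(g) ↔ θ_g ∉ 𝔮ₓ`** for `x ∈ D₊(s)` (`s`, `g` homogeneous of positive degrees), `𝔮ₓ` the point of
`Spec A_{(s)}` corresponding to `x`, `θ_g = g^{deg s}/s^{deg g}`. [folklore] -/
theorem ι_base_mem_basicOpen_iff {A σ' : Type*} [CommRing A] [SetLike σ' A] [AddSubgroupClass σ' A]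
    (𝒜 : ℕ → σ') [GradedRing 𝒜] {s : A} {m : ℕ} (hs : s ∈ 𝒜 m) (hm : 0 < m) {g : A} {m' : ℕ}
    (hg : g ∈ 𝒜 m') (hm' : 0 < m')
    (x : ((Proj.basicOpen 𝒜 s : (Proj 𝒜).Opens) : Scheme)) :
    (Proj.basicOpen 𝒜 s).ι.base x ∈ Proj.basicOpen 𝒜 g ↔
      (Proj.basicOpenIsoSpec 𝒜 s hs hm).hom.base x ∈
        PrimeSpectrum.basicOpen (Away.isLocalizationElem hs hg) := by
  have hι : (Proj.basicOpen 𝒜 s).ι =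
      (Proj.basicOpenIsoSpec 𝒜 s hs hm).hom ≫ Proj.awayι 𝒜 s hs hm := by
    rw [← Proj.basicOpenIsoSpec_inv_ι, Iso.hom_inv_id_assoc]
  have h := Proj.awayι_preimage_basicOpen 𝒜 hs hm hg hm'
  have hb : (Proj.basicOpen 𝒜 s).ι.base x =
      (Proj.awayι 𝒜 s hs hm).base ((Proj.basicOpenIsoSpec 𝒜 s hs hm).hom.base x) := by
    rw [hι]; rfl
  rw [hb]
  change (Proj.basicOpenIsoSpec 𝒜 s hs hm).hom.base x ∈ Proj.awayι 𝒜 s hs hm ⁻¹ᵁ Proj.basicOpen 𝒜 g ↔ _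
  rw [h]
  rfl

/-- **Basic opens of sections coming from `Spec A_{(s)}`**: for `y ∈ A_{(s)}`,
`x ∈ (↥D₊(s)).basicOpen ((basicOpenToSpec).appTop (y)) ↔ y ∉ 𝔮ₓ`. [folklore] -/
theorem mem_basicOpen_basicOpenToSpec_appTop_iff {A σ' : Type*} [CommRing A] [SetLike σ' A]
    [AddSubgroupClass σ' A] (𝒜 : ℕ → σ') [GradedRing 𝒜] (s : A)
    (x : ((Proj.basicOpen 𝒜 s : (Proj 𝒜).Opens) : Scheme)) (y : Away 𝒜 s) :
    x ∈ ((Proj.basicOpen 𝒜 s : (Proj 𝒜).Opens) : Scheme).basicOpen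
        ((Proj.basicOpenToSpec 𝒜 s).appTop ((Scheme.ΓSpecIso (CommRingCat.of (Away 𝒜 s))).inv y)) ↔
      (Proj.basicOpenToSpec 𝒜 s).base x ∈ PrimeSpectrum.basicOpen y := by
  rw [← Scheme.preimage_basicOpen_top, basicOpen_eq_of_affine]
  rfl

variable {R : Type u} [CommRing R] {I : Ideal R}

section Seam

variable {G : Type*} [Group G] [MulSemiringAction G R]
  (ρ : G →* Aut (Spec (CommRingCat.of R)))
  (hρ : ∀ g : G, (ρ g).hom = Spec.map (CommRingCat.ofHom
    ((MulSemiringAction.toRingEquiv G R g⁻¹ : R ≃+* R) : R →+* R)))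
  (hJ : ∀ g : G, (affineBlowup.idealSheaf I).comap (ρ g).hom = affineBlowup.idealSheaf I)
  {Y : Scheme.{u}} (q : Spec (CommRingCat.of R) ⟶ Y)
  (ρB : ActionOver (affineBlowup.π I ≫ q) G)
  (haut : ∀ g : G, (ρB.aut g).hom = ((affineBlowup.isBlowup I).liftAction ρ hJ g).hom)
  (s : reesAlgebra I) {m : ℕ} (hs : s ∈ reesGrading I m) (hm : 0 < m)
  (φ : G → (reesGrading I →+*ᵍ reesGrading I))
  (hφ : ∀ (g : G) (x : reesAlgebra I), ((φ g x : reesAlgebra I) : R[X]) =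
    (x : R[X]).map ((MulSemiringAction.toRingEquiv G R g⁻¹ : R ≃+* R) : R →+* R))
  (hf : ∀ g : G, HomogeneousIdeal.irrelevant (reesGrading I) ≤
    (HomogeneousIdeal.irrelevant (reesGrading I)).map (φ g))
  (hφs : ∀ g : G, φ g s = s)
  (hP : ∀ g : G, Submonoid.powers s ≤ (Submonoid.powers s).comap (φ g))
  (hO : ∀ g : G, (ρB.aut g).hom ⁻¹ᵁ Proj.basicOpen (reesGrading I) s = Proj.basicOpen (reesGrading I) s)

-- the literal `ActionOver`/`Proj` terms are large: head-room for the statement and the point clause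
set_option maxHeartbeats 1600000 in
include hρ haut hs hm hφ hf hφs in
/-- **THE SEAM WITH POINTS** for the stable chart `O = D₊(s)` of `Bl_I(Spec R)`: the ring isomorphism
`Ω : (R[It])_{(s)} ≃ Γ(↥D₊(s), ⊤)` of `exists_basicOpen_sectionsEquiv` with (i) `Ω(r/1) = (D₊(s) ↪ Bl → Spec R)^* r`,
(ii) `act g (Ω y) = Ω (HomogeneousLocalization.map (φ g⁻¹) y)`, and (iii) `x ∈ basicOpen (Ω y) ↔ y ∉ 𝔮ₓ` for the
point `𝔮ₓ ∈ Spec (R[It])_{(s)}` of `x` under `Proj.basicOpenIsoSpec`. [folklore] -/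
theorem exists_basicOpen_sectionsEquiv_points :
    ∃ Ω : HomogeneousLocalization.Away (reesGrading I) s ≃+*
        Γ(((Proj.basicOpen (reesGrading I) s : (affineBlowup I).Opens) : Scheme.{u}),
          ((Proj.basicOpen (reesGrading I) s).ι ≫ affineBlowup.π I ≫ q) ⁻¹ᵁ ⊤),
      (∀ r : R, Ω (((fromZeroRingHom (reesGrading I) (.powers s)).comp (reesGrading.zeroRingHom I)) r) =
        ((Proj.basicOpen (reesGrading I) s).ι ≫ affineBlowup.π I).appLE ⊤
          (((Proj.basicOpen (reesGrading I) s).ι ≫ affineBlowup.π I ≫ q) ⁻¹ᵁ ⊤) le_top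
          ((Scheme.ΓSpecIso (CommRingCat.of R)).inv r)) ∧
      (∀ (g : G) (y : HomogeneousLocalization.Away (reesGrading I) s),
        (ρB.restrict (Proj.basicOpen (reesGrading I) s) hO).act g ⊤ (Ω y) =
          Ω (HomogeneousLocalization.map (φ g⁻¹) (hP g⁻¹) y)) ∧
      (∀ (x : ((Proj.basicOpen (reesGrading I) s : (affineBlowup I).Opens) : Scheme.{u}))
        (y : HomogeneousLocalization.Away (reesGrading I) s),
        x ∈ (((Proj.basicOpen (reesGrading I) s : (affineBlowup I).Opens) : Scheme.{u})).basicOpen (Ω y) ↔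
          (Proj.basicOpenIsoSpec (reesGrading I) s hs hm).hom.base x ∈ PrimeSpectrum.basicOpen y) := by
  -- the isomorphism `θ : (R[It])_{(s)} → Γ(Bl, D₊(s)) → Γ(↥D₊(s), ⊤)`
  haveI : IsIso (Proj.awayToSection (reesGrading I) s) := by
    rw [← Proj.basicOpenIsoAway_hom _ s hs hm]; infer_instance
  have hle : (((Proj.basicOpen (reesGrading I) s).ι ≫ affineBlowup.π I ≫ q) ⁻¹ᵁ ⊤) ≤
      (Proj.basicOpen (reesGrading I) s).ι ⁻¹ᵁ Proj.basicOpen (reesGrading I) s := fun x _ => x.2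
  have hθ : (Proj.basicOpen (reesGrading I) s).ι.appLE (Proj.basicOpen (reesGrading I) s)
      (((Proj.basicOpen (reesGrading I) s).ι ≫ affineBlowup.π I ≫ q) ⁻¹ᵁ ⊤) hle =
      (Proj.basicOpen (reesGrading I) s).topIso.inv :=
    ι_appLE_eq_topIso_inv _ _
  let θ : CommRingCat.of (HomogeneousLocalization.Away (reesGrading I) s) ⟶
      Γ(((Proj.basicOpen (reesGrading I) s : (affineBlowup I).Opens) : Scheme.{u}),
        ((Proj.basicOpen (reesGrading I) s).ι ≫ affineBlowup.π I ≫ q) ⁻¹ᵁ ⊤) :=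
    Proj.awayToSection (reesGrading I) s ≫ (Proj.basicOpen (reesGrading I) s).topIso.inv
  haveI : IsIso θ := IsIso.comp_isIso
  have hθapp : ∀ y, (asIso θ).commRingCatIsoToRingEquiv y =
      (Proj.basicOpen (reesGrading I) s).ι.appLE (Proj.basicOpen (reesGrading I) s)
        (((Proj.basicOpen (reesGrading I) s).ι ≫ affineBlowup.π I ≫ q) ⁻¹ᵁ ⊤) hle
        (Proj.awayToSection (reesGrading I) s y) := by
    intro y
    rw [hθ]
    rfl
  -- `θ y` is the pull-back of `y` along `basicOpenToSpec`
  have hθspec : ∀ y, (asIso θ).commRingCatIsoToRingEquiv y =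
      (Proj.basicOpenToSpec (reesGrading I) s).appTop
        ((Scheme.ΓSpecIso (CommRingCat.of (HomogeneousLocalization.Away (reesGrading I) s))).inv y) := by
    intro y
    rw [hθapp, hθ]
    change _ = ((Proj.basicOpenToSpec (reesGrading I) s).app ⊤) _
    rw [Proj.basicOpenToSpec_app_top, ← CommRingCat.comp_apply (Scheme.ΓSpecIso _).inv]
    erw [Iso.inv_hom_id_assoc]
    rfl
  refine ⟨(asIso θ).commRingCatIsoToRingEquiv, fun r => ?_, fun g y => ?_, fun x y => ?_⟩
  · -- (i)
    rw [hθapp, ← appLE_π_eq_awayToSection s hs hm le_top r, ← CommRingCat.comp_apply,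
      Scheme.Hom.appLE_comp_appLE]
  · -- (ii)
    have hst : Proj.basicOpen (reesGrading I) s ≤
        (ρB.aut g⁻¹).hom ⁻¹ᵁ Proj.basicOpen (reesGrading I) s := (hO g⁻¹).ge
    have k2 : Proj.awayToSection (reesGrading I) s ≫
        (ρB.aut g⁻¹).hom.appLE (Proj.basicOpen (reesGrading I) s) (Proj.basicOpen (reesGrading I) s)
          hst =
        CommRingCat.ofHom (HomogeneousLocalization.map (φ g⁻¹) (hP g⁻¹)) ≫
          Proj.awayToSection (reesGrading I) s := by
      rw [appLE_congr_hom (haut g⁻¹)]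
      exact ToricExit.awayToSection_comp_appLE_liftAction ρ hρ hJ g⁻¹ (φ g⁻¹) (hφ g⁻¹) (hf g⁻¹)
        s s (hφs g⁻¹) hs (hP g⁻¹) _
    rw [hθapp, hθapp, restrict_act_ι_appLE ρB (Proj.basicOpen (reesGrading I) s) hO g hle]
    congr 1
    rw [← CommRingCat.comp_apply, k2, CommRingCat.comp_apply]
    rfl
  · -- (iii): the opens `(ι ≫ π ≫ q)⁻¹ ⊤` and `⊤` of `↥D₊(s)` agree definitionally
    rw [hθspec]
    change x ∈ (((Proj.basicOpen (reesGrading I) s : (affineBlowup I).Opens) : Scheme.{u})).basicOpen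
        ((Proj.basicOpenToSpec (reesGrading I) s).appTop ((Scheme.ΓSpecIso
          (CommRingCat.of (HomogeneousLocalization.Away (reesGrading I) s))).inv y)) ↔ _
    rw [mem_basicOpen_basicOpenToSpec_appTop_iff, Proj.basicOpenIsoSpec_hom]

end Seam

section SeamVar

variable {G : Type*} [Group G] [MulSemiringAction G R]

/-- **THE SEAM WITH POINTS, stable open given as a variable** `O` with `hOs : O = D₊(s)` (keeps callers' statements
small): clause (iii) packaged as a prime `𝔮ₓ` of `(R[It])_{(s)}` for every `x ∈ O` with
`x ∈ basicOpen (Ω y) ↔ y ∉ 𝔮ₓ` and `x ∈ D₊(g) ↔ θ_g ∉ 𝔮ₓ` for homogeneous `g` of positive degree. [folklore] -/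
theorem exists_basicOpen_sectionsEquiv_points'
    (ρ : G →* Aut (Spec (CommRingCat.of R)))
    (hρ : ∀ g : G, (ρ g).hom = Spec.map (CommRingCat.ofHom
      ((MulSemiringAction.toRingEquiv G R g⁻¹ : R ≃+* R) : R →+* R)))
    (hJ : ∀ g : G, (affineBlowup.idealSheaf I).comap (ρ g).hom = affineBlowup.idealSheaf I)
    {Y : Scheme.{u}} (q : Spec (CommRingCat.of R) ⟶ Y)
    (ρB : ActionOver (affineBlowup.π I ≫ q) G)
    (haut : ∀ g : G, (ρB.aut g).hom = ((affineBlowup.isBlowup I).liftAction ρ hJ g).hom)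
    (s : reesAlgebra I) {m : ℕ} (hs : s ∈ reesGrading I m) (hm : 0 < m)
    (φ : G → (reesGrading I →+*ᵍ reesGrading I))
    (hφ : ∀ (g : G) (x : reesAlgebra I), ((φ g x : reesAlgebra I) : R[X]) =
      (x : R[X]).map ((MulSemiringAction.toRingEquiv G R g⁻¹ : R ≃+* R) : R →+* R))
    (hf : ∀ g : G, HomogeneousIdeal.irrelevant (reesGrading I) ≤
      (HomogeneousIdeal.irrelevant (reesGrading I)).map (φ g))
    (hφs : ∀ g : G, φ g s = s)
    (hP : ∀ g : G, Submonoid.powers s ≤ (Submonoid.powers s).comap (φ g))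
    (O : (affineBlowup I).Opens)
    (hO' : ∀ g : G, (ρB.aut g).hom ⁻¹ᵁ O = O) (hOs : O = Proj.basicOpen (reesGrading I) s) :
    ∃ Ω : HomogeneousLocalization.Away (reesGrading I) s ≃+*
        Γ((O : Scheme.{u}), (O.ι ≫ affineBlowup.π I ≫ q) ⁻¹ᵁ ⊤),
      (∀ r : R, Ω (((fromZeroRingHom (reesGrading I) (.powers s)).comp (reesGrading.zeroRingHom I)) r) =
        (O.ι ≫ affineBlowup.π I).appLE ⊤ ((O.ι ≫ affineBlowup.π I ≫ q) ⁻¹ᵁ ⊤) le_top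
          ((Scheme.ΓSpecIso (CommRingCat.of R)).inv r)) ∧
      (∀ (g : G) (y : HomogeneousLocalization.Away (reesGrading I) s),
        (ρB.restrict O hO').act g ⊤ (Ω y) = Ω (HomogeneousLocalization.map (φ g⁻¹) (hP g⁻¹) y)) ∧
      (∀ x : (O : Scheme.{u}), ∃ 𝔮 : PrimeSpectrum (HomogeneousLocalization.Away (reesGrading I) s),
        (∀ y : HomogeneousLocalization.Away (reesGrading I) s,
          x ∈ (O : Scheme.{u}).basicOpen (Ω y) ↔ y ∉ 𝔮.asIdeal) ∧
        (∀ (g' : reesAlgebra I) (m' : ℕ) (hg' : g' ∈ reesGrading I m') (_ : 0 < m'),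
          O.ι.base x ∈ Proj.basicOpen (reesGrading I) g' ↔
            Away.isLocalizationElem hs hg' ∉ 𝔮.asIdeal)) := by
  subst hOs
  obtain ⟨Ω, h1, h2, h3⟩ := exists_basicOpen_sectionsEquiv_points ρ hρ hJ q ρB haut s hs hm φ hφ hf hφs hP hO'
  refine ⟨Ω, h1, h2, fun x => ⟨(Proj.basicOpenIsoSpec (reesGrading I) s hs hm).hom.base x, fun y => ?_,
    fun g' m' hg' hm' => ?_⟩⟩
  · rw [h3]; rfl
  · rw [ι_base_mem_basicOpen_iff (reesGrading I) hs hm hg' hm' x]; rfl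


end SeamVar

end Summit.ResolutionOfSingularities.ResolutionOfSingularities.Theorems.WildQuotientResolution.BlowupExit

end
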